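import Summits.QuantumAdvantage.QuantumAdvantage.Theorems.NullTwistA

/-! # NullTwistB — part 2/3 (mechanical split for landing of `NullTwist`; content verbatim; scopes re-opened with their variables) -/

set_option linter.dupNamespace false

namespace Summit.QuantumAdvantage.AdviceFreeQNC0.NullTwist
open Classical
open Finset
open Summit.QuantumAdvantage.AdviceFreeQNC0
open Summit.QuantumAdvantage.AdviceFreeQNC0.RegisterRotation
open Literature.Computability.MetaComplexity Literature.Computability.MetaComplexity.Smolensky
variable {n : ℕ}

section Kill

/-- NullTwist helper `polylog_step` (decomp-qadv land package; see the module docstring). -/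
theorem polylog_step {n : ℕ} (hn : 32 ≤ n) (C : ℕ) :
    (Nat.log 2 n) ^ C + 4 ≤ (Nat.log 2 n) ^ (C + 1) ∧ 2 * (Nat.log 2 n) ^ (C + 1) ≤ (Nat.log 2 n) ^ (C + 2) ∧
      (Nat.log 2 n) ^ C ≤ (Nat.log 2 n) ^ (C + 1) := by
  have h5 := five_le_log_of_le hn
  have h1 : 1 ≤ (Nat.log 2 n) ^ C := Nat.one_le_pow _ _ (by omega)
  have h1' : 1 ≤ (Nat.log 2 n) ^ (C + 1) := Nat.one_le_pow _ _ (by omega)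
  refine ⟨?_, ?_, Nat.pow_le_pow_right (by omega) (Nat.le_succ C)⟩
  · rw [pow_succ]; nlinarith
  · have e : (Nat.log 2 n) ^ (C + 2) = (Nat.log 2 n) ^ (C + 1) * Nat.log 2 n := pow_succ _ _
    rw [e]; nlinarith

/-- NullTwist helper `card_cube` (decomp-qadv land package; see the module docstring). -/
theorem card_cube (n : ℕ) : (Finset.univ : Finset (Fin n → Bool)).card = 2 ^ n := by
  rw [Finset.card_univ, Fintype.card_fun, Fintype.card_bool, Fintype.card_fin]


/-- the three class-complements cover every input exactly twice. -/
theorem card_ne_cls_sum (n : ℕ) :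
    (univ.filter fun u : Fin n → Bool => wt u % 3 ≠ 2 * 0 % 3).card +
      (univ.filter fun u : Fin n → Bool => wt u % 3 ≠ 2 * 1 % 3).card +
      (univ.filter fun u : Fin n → Bool => wt u % 3 ≠ 2 * 2 % 3).card = 2 * 2 ^ n := by
  rw [Finset.card_filter, Finset.card_filter, Finset.card_filter, ← Finset.sum_add_distrib,
    ← Finset.sum_add_distrib]
  rw [show 2 * 2 ^ n = ∑ _u : Fin n → Bool, 2 by rw [Finset.sum_const, card_cube, smul_eq_mul, mul_comm]]
  exact Finset.sum_congr rfl fun u _ => by split_ifs <;> omega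

/-- **THE KILL THEOREM, unconditional**: for every prime `p ≠ 3`, uniform polylog smoothability of near-perfect
registers already gives walk hardness — `SmoothableF p → WalkHardF p`. -/
theorem walkHardF_of_uniformSmooth (p : ℕ) [hp : Fact p.Prime]
    (hSmol : ∀ {m D : ℕ}, (p - 1) * D < m → ∀ {h : (Fin m → Bool) → Bool}, HasDegF p h D → ∀ r : ℕ,
      (univ.filter fun u : Fin m → Bool => h u = decide (wt u % 3 = r % 3)).card ≤
        (univ.filter fun u : Fin m → Bool => wt u % 3 ≠ r % 3).card + ((p - 1) * D + 1) * m.choose (m / 2))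
    (hS : ∀ θ' : ℝ, θ' < 1 → ∃ ε : ℝ, 0 < ε ∧ ∀ C : ℕ, ∃ n₀ : ℕ, ∀ n ≥ n₀, ∀ c : ℕ,
      ∀ y : Fin (n + 1) → (Fin n → Bool) → Bool, (∀ g, HasDegF p (y g) ((Nat.log 2 n) ^ C)) →
        (1 - ε) * (2 : ℝ) ^ n ≤ ((univ.filter fun u : Fin n → Bool => ringWinU c y u = true).card : ℝ) →
          ∃ f : (Fin n → Bool) → Bool, HasDegF p f ((Nat.log 2 n) ^ C) ∧
            θ' * (2 : ℝ) ^ n ≤ ((univ.filter fun u : Fin n → Bool => smoothWin c y f u = true).card : ℝ)) :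
    WalkHardF p := by
  have hp1 : 1 ≤ p := hp.out.one_lt.le
  obtain ⟨ε, hε, hSC⟩ := hS (23 / 24) (by norm_num)
  refine ⟨1 - ε, by linarith, fun C => ?_⟩
  obtain ⟨n₂, hn₂⟩ := hSC (C + 1)
  obtain ⟨n₃, hn₃⟩ := logPow_le_sqrt' (C + 2) (c₀ := 1 / (6 * p)) (by positivity)
  refine ⟨max (max n₂ n₃) 32, fun n hn c y hy => ?_⟩
  have hn2 : n₂ ≤ n := le_trans (le_trans (le_max_left _ _) (le_max_left _ _)) hn
  have hn3 : n₃ ≤ n := le_trans (le_trans (le_max_right _ _) (le_max_left _ _)) hn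
  have hn32 : 32 ≤ n := le_trans (le_max_right _ _) hn
  have hn1 : 1 ≤ n := by omega
  obtain ⟨hstep1, hstep2, hstep3⟩ := polylog_step hn32 C
  obtain ⟨L, hL⟩ : ∃ L : ℕ, L = (Nat.log 2 n) ^ (C + 2) := ⟨_, rfl⟩
  have hL1 : 1 ≤ L := by rw [hL]; exact Nat.one_le_pow _ _ (by have := five_le_log_of_le hn32; omega)
  -- the analytic budget: ((p−1)L+1)·C(n, n/2) ≤ 2ⁿ/6 and (p−1)L < n
  have hnR : (0 : ℝ) < n := by exact_mod_cast (show 0 < n by omega)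
  have hsq : 0 < Real.sqrt n := Real.sqrt_pos.mpr hnR
  have hlog : ((L : ℕ) : ℝ) ≤ 1 / (6 * p) * Real.sqrt n := by rw [hL]; exact hn₃ n hn3
  have hpR : (1 : ℝ) ≤ p := by exact_mod_cast hp1
  have hK : (p - 1) * L + 1 ≤ p * L := by
    have e : (p - 1) * L + L = p * L := by
      calc (p - 1) * L + L = (p - 1 + 1) * L := by ring
        _ = p * L := by rw [Nat.sub_add_cancel hp1]
    omega
  have hKR : (((p - 1) * L + 1 : ℕ) : ℝ) ≤ (p : ℝ) * L := by exact_mod_cast hK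
  have hpL : (p : ℝ) * L ≤ Real.sqrt n / 6 := by
    calc (p : ℝ) * L ≤ p * (1 / (6 * p) * Real.sqrt n) := by gcongr
      _ = Real.sqrt n / 6 := by field_simp
  have hn1R : (1 : ℝ) ≤ n := by exact_mod_cast hn1
  have hsqn : Real.sqrt n ≤ n := by
    calc Real.sqrt n ≤ Real.sqrt ((n : ℝ) ^ 2) := Real.sqrt_le_sqrt (by nlinarith)
      _ = n := Real.sqrt_sq hnR.le
  have hDn : (p - 1) * L < n := by
    have h1 : (((p - 1) * L : ℕ) : ℝ) ≤ (p : ℝ) * L := by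
      have : (p - 1) * L ≤ p * L := Nat.mul_le_mul_right _ (Nat.sub_le p 1)
      exact_mod_cast this
    have h2 : (((p - 1) * L : ℕ) : ℝ) < n := by linarith
    exact_mod_cast h2
  obtain ⟨K, hKdef⟩ : ∃ K : ℕ, K = ((p - 1) * L + 1) * n.choose (n / 2) := ⟨_, rfl⟩
  have hKC : (K : ℝ) ≤ 2 ^ n / 6 := by
    rw [hKdef, Nat.cast_mul]
    have hch := Summit.QuantumAdvantage.DigitPolyUniformity.SketchLAR.stub_choose_middle_le n hn1
    calc (((p - 1) * L + 1 : ℕ) : ℝ) * (n.choose (n / 2) : ℝ) ≤ (Real.sqrt n / 6) * (2 ^ n / Real.sqrt n) :=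
          mul_le_mul (le_trans hKR hpL) hch (by positivity) (by positivity)
      _ = 2 ^ n / 6 := by field_simp
  -- the extremal object
  by_contra hlt
  have hbig : (1 - ε) * (2 : ℝ) ^ n ≤
      ((univ.filter fun u : Fin n → Bool => ringWinU c y u = true).card : ℝ) := (not_le.mp hlt).le
  have hy1 : ∀ g, HasDegF p (y g) ((Nat.log 2 n) ^ (C + 1)) := fun g => by
    have := hy g; unfold HasDegF at this ⊢; exact lowDeg_mono hstep3 this
  obtain ⟨f, hf, hfs⟩ := hn₂ n hn2 c y hy1 hbig
  -- one twist per residue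
  have key : ∀ k : ℕ, (11 / 12 : ℝ) * (2 : ℝ) ^ n ≤
      ((univ.filter fun u : Fin n → Bool => wt u % 3 ≠ 2 * k % 3).card : ℝ) + 2 ^ n / 6 := by
    intro k
    set z : Fin (n + 1) → (Fin n → Bool) → Bool := nullTw c k (fun _ => true) with hz
    have hz0 : ∀ u, ringWinU c z u = false := fun u => ringWinU_nullTw hn1 c k _ u
    have hz1 : ∀ u, ringWinU (c + 1) z u = !decide ((k + wt u) % 3 = 0) := fun u => by
      rw [hz, ringWinU_nullTw_succ hn1, Bool.true_and]
    have hzdeg : ∀ g, HasDegF p (z g) (4 * (0 + 1)) := fun g => hasDegF_nullTw c k (RigidityLaws.hasDegF_const p true 0) g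
    set y' := xorStrat y z with hy'
    have hy'1 : ∀ g, HasDegF p (y' g) ((Nat.log 2 n) ^ (C + 1)) := fun g => by
      have := hasDegF_xorStrat hy hzdeg g; unfold HasDegF at this ⊢; exact lowDeg_mono (by omega) this
    have hwin' : (univ.filter fun u : Fin n → Bool => ringWinU c y' u = true) =
        univ.filter fun u : Fin n → Bool => ringWinU c y u = true :=
      Finset.filter_congr fun u _ => by rw [hy', ringWinU_xorStrat, hz0 u, Bool.xor_false]
    obtain ⟨f', hf', hfs'⟩ := hn₂ n hn2 c y' hy'1 (by rw [hwin']; exact hbig)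
    set A := univ.filter fun u : Fin n → Bool => smoothWin c y f u = true with hA
    set B := univ.filter fun u : Fin n → Bool => smoothWin c y' f' u = true with hB
    set M := univ.filter fun u : Fin n → Bool =>
      (!(Bool.xor (f u) (f' u))) = decide (wt u % 3 = 2 * k % 3) with hMset
    have hsub : A ∩ B ⊆ M := by
      intro u hu
      rw [Finset.mem_inter, hA, hB, Finset.mem_filter, Finset.mem_filter] at hu
      obtain ⟨⟨_, ha⟩, ⟨_, hb⟩⟩ := hu
      unfold smoothWin at ha hb
      rw [Bool.and_eq_true, beq_iff_eq] at ha hb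
      rw [hMset, Finset.mem_filter]
      refine ⟨Finset.mem_univ _, ?_⟩
      have hside' : ringWinU (c + 1) y' u = Bool.xor (ringWinU (c + 1) y u) (ringWinU (c + 1) z u) := by
        rw [hy', ringWinU_xorStrat]
      have hdec : decide ((k + wt u) % 3 = 0) = decide (wt u % 3 = 2 * k % 3) := by
        rw [decide_eq_decide]; constructor <;> intro h <;> omega
      rw [← ha.2, ← hb.2, hside', hz1 u, ← hdec]
      cases ringWinU (c + 1) y u <;> cases decide ((k + wt u) % 3 = 0) <;> rfl
    have hcard : A.card + B.card ≤ 2 ^ n + M.card := by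
      have h1 := Finset.card_union_add_card_inter A B
      have h2 : (A ∪ B).card ≤ 2 ^ n := by rw [← card_cube n]; exact Finset.card_le_univ _
      have h3 := Finset.card_le_card hsub
      omega
    have hdeg : HasDegF p (fun u => !(Bool.xor (f u) (f' u))) L := by
      have := hasDegF_not (RigidityLaws.hasDegF_xor hf hf'); unfold HasDegF at this ⊢
      exact lowDeg_mono (by rw [hL]; omega) this
    have hM : M.card ≤ (univ.filter fun u : Fin n → Bool => wt u % 3 ≠ 2 * k % 3).card +
        ((p - 1) * L + 1) * n.choose (n / 2) := hSmol hDn hdeg (2 * k)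
    rw [← hKdef] at hM
    have hMR : (M.card : ℝ) ≤ ((univ.filter fun u : Fin n → Bool => wt u % 3 ≠ 2 * k % 3).card : ℝ) + K := by
      exact_mod_cast hM
    have hcardR : (A.card : ℝ) + B.card ≤ (2 : ℝ) ^ n + M.card := by exact_mod_cast hcard
    linarith
  have k0 := key 0
  have k1 := key 1
  have k2 := key 2
  have hsumR : ((univ.filter fun u : Fin n → Bool => wt u % 3 ≠ 2 * 0 % 3).card : ℝ) +
      ((univ.filter fun u : Fin n → Bool => wt u % 3 ≠ 2 * 1 % 3).card : ℝ) +
      ((univ.filter fun u : Fin n → Bool => wt u % 3 ≠ 2 * 2 % 3).card : ℝ) = 2 * (2 : ℝ) ^ n := by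
    exact_mod_cast card_ne_cls_sum n
  have h2 : (0 : ℝ) < (2 : ℝ) ^ n := by positivity
  linarith


end Kill

/-! ## §3 Fibrewise smoothing over the weight class mod 3 -/

section Fibre

/-- the weight class `wt(u) mod 3`. -/
def wtCls (u : Fin n → Bool) : Fin 3 := ⟨wt u % 3, Nat.mod_lt _ (by norm_num)⟩

/-- FIBREWISE-SMOOTH WIN: `y` wins at `c` and its side bit equals the class test `F_{wt(u) mod 3}(u)`. -/
def fibreWin (c : ℕ) (y : Fin (n + 1) → (Fin n → Bool) → Bool) (F : Fin 3 → (Fin n → Bool) → Bool)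
    (u : Fin n → Bool) : Bool :=
  ringWinU c y u && (ringWinU (c + 1) y u == F (wtCls u) u)

/-- a constant family is the uniform smooth win. -/
theorem fibreWin_const (c : ℕ) (y : Fin (n + 1) → (Fin n → Bool) → Bool) (f : (Fin n → Bool) → Bool)
    (u : Fin n → Bool) : fibreWin c y (fun _ => f) u = smoothWin c y f u := rfl

/-- NullTwist helper `decide_cls` (decomp-qadv land package; see the module docstring). -/
theorem decide_cls (k : ℕ) (u : Fin n → Bool) :
    decide ((k + (wtCls u).val) % 3 = 0) = decide ((k + wt u) % 3 = 0) := by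
  rw [decide_eq_decide]
  show (k + wt u % 3) % 3 = 0 ↔ (k + wt u) % 3 = 0
  constructor <;> intro h <;> omega

/-- NullTwist helper `wtCls_eq_zero` (decomp-qadv land package; see the module docstring). -/
theorem wtCls_eq_zero {u : Fin n → Bool} (hr : wt u % 3 = 0) : wtCls u = 0 := by
  unfold wtCls; ext; simpa using hr
/-- NullTwist helper `wtCls_eq_one` (decomp-qadv land package; see the module docstring). -/
theorem wtCls_eq_one {u : Fin n → Bool} (hr : wt u % 3 = 1) : wtCls u = 1 := by
  unfold wtCls; ext; simpa using hr
/-- NullTwist helper `wtCls_eq_two` (decomp-qadv land package; see the module docstring). -/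
theorem wtCls_eq_two {u : Fin n → Bool} (hr : wt u % 3 = 2) : wtCls u = 2 := by
  unfold wtCls; ext; simpa using hr

/-- **TWIST COVARIANCE of fibrewise smoothness**: twisting by `nullTw c k t` maps the witness family `F` to
`F_j ⊕ (t ∧ [k + j ≢ 0 (mod 3)])` — fibrewise-smooth wins are invariant under the `x + x²` null-twist module (class-test
degree `+ deg t + O(1)`), whereas uniformly smooth wins are not (§2). -/
theorem fibreWin_nullTw (hn : 1 ≤ n) (c k : ℕ) (y : Fin (n + 1) → (Fin n → Bool) → Bool) (t : (Fin n → Bool) → Bool)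
    (F : Fin 3 → (Fin n → Bool) → Bool) (u : Fin n → Bool) :
    fibreWin c (xorStrat y (nullTw c k t)) (fun j v => Bool.xor (F j v) (t v && !decide ((k + j.val) % 3 = 0))) u =
      fibreWin c y F u := by
  unfold fibreWin
  rw [ringWinU_xorStrat, ringWinU_xorStrat, ringWinU_nullTw hn, ringWinU_nullTw_succ hn, Bool.xor_false]
  dsimp only
  rw [decide_cls]
  cases ringWinU c y u <;> cases ringWinU (c + 1) y u <;> cases F (wtCls u) u <;> cases t u <;>
    cases decide ((k + wt u) % 3 = 0) <;> rfl

/-- **null twists act through their side effect**: for ANY strategy `z` that is exactly null at charge `c` on an input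
`u`, twisting by `z` preserves the fibrewise-smooth win at `u` once the family is shifted by `z`'s SIDE EFFECT `WIN_{c+1}(z)`.
So a null twist can change fibrewise-smooth win counts (at bounded class-test degree) only if its side effect is not almost
everywhere fibrewise of that degree. -/
theorem fibreWin_twist_of_null (c : ℕ) (y z : Fin (n + 1) → (Fin n → Bool) → Bool)
    (F : Fin 3 → (Fin n → Bool) → Bool) (u : Fin n → Bool) (hz : ringWinU c z u = false) :
    fibreWin c (xorStrat y z) (fun j v => Bool.xor (F j v) (ringWinU (c + 1) z v)) u = fibreWin c y F u := by
  unfold fibreWin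
  rw [ringWinU_xorStrat, ringWinU_xorStrat, hz, Bool.xor_false]
  dsimp only
  cases ringWinU c y u <;> cases ringWinU (c + 1) y u <;> cases F (wtCls u) u <;> cases ringWinU (c + 1) z u <;> rfl


end Fibre
end Summit.QuantumAdvantage.AdviceFreeQNC0.NullTwist
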